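import Mathlib
import Summits.ValiantsHypothesis.ValiantsHypothesis.Theorems.KPlusLogSqLawLiftingLocalDescartes
import Summits.ValiantsHypothesis.ValiantsHypothesis.Theorems.KPlusLogSqLawLiftingExactPatchwork

/-!
# The local Descartes rule, one-sided: Laguerre's rules below / above an archimedean dominance point

HONEST FRAMING.  Helper file toward the lifting crux `WeakLifting` (stmt-ValiantsHypothesis-19561; aside `Lifting`
stmt-ValiantsHypothesis-19772, registered stub `stub_liftThin`) of route `KPlusLogSqLaw` (cell `pub-symmetroid`, seat
val-sym-lift-p1 g9, 2026-08-27).  Elementary facts about ONE real polynomial; nothing here asserts `WeakLifting`, `TropicalB`,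
Conjecture B, `MatrixDescartes` (stmt-ValiantsHypothesis-18050) or anything about VP ≠ VNP.

SETTING.  `f = Σ c_i X^i` real, and «`x^u` DOMINATES `f` at `a > 0`» means `Σ_{i ≠ u} |c_i| a^i < |c_u| a^u` (the archimedean
dominance of the cell's `…LiftingNewtonWindows` / `…LiftingLocalDescartes`).  The LOCAL DESCARTES RULE of the previous seat
(`LocalDescartes.card_roots_Ioo_le_signVar_coeffs`, g8): between two dominance points `a < b` of `x^u`, `x^w` (`u ≤ w`) the
number of distinct zeros is at most `Var(c_u, …, c_w)`.  This file adds: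
* `le_of_dominant_of_lt` — exponents of dominance points increase with the point (`a < b ⇒ u ≤ w`; the pencil twin of the
  tree's `TropicalCensus.slope_lt_of_dominant`);
* `eval_ne_zero_of_dominant_of_forall_le` / `…_forall_ge` — if the dominant exponent is the least / the largest exponent of the
  support, there is no zero on `(0, a]` / `[a, ∞)`;
* `exists_dominant_trailing` / `exists_dominant_leading` — the trailing monomial dominates at all sufficiently small points,
  the leading one at all sufficiently large points (explicit thresholds, no limits);
* `signVar_append_of_forall_eq_zero`, `signVar_window_of_noInterior` — `Var` bookkeeping: zero prefixes drop, and a coefficient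
  window `(c_u, …, c_w)` with no support exponent strictly inside has `Var = [c_u c_w < 0]`;
* `card_roots_lt_le_signVar` / `card_roots_gt_le_signVar` — LAGUERRE'S ONE-SIDED RULES in dominance form: if `x^w` dominates
  at `a`, the zeros in `(0, a)` number at most `Var(c_0, …, c_w)` and the zeros in `(a, ∞)` at most `Var(c_w, …, c_n)`, `n`
  the degree (from the two-sided rule with an auxiliary extreme dominance point below / above every zero).
The companion `…LocalDescartesChain` sums these over a chain of dominance points.  No `def`.
[folklore] (Laguerre's extension of Descartes' rule, [VanMieghem2010, art. 317, Thm 88]; the dominance form is ours.)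
-/

set_option linter.dupNamespace false
set_option autoImplicit false

namespace Summit.ValiantsHypothesis.ValiantsHypothesis.Theorems.KPlusLogSqLaw.LocalDescartes

open Set Finset Polynomial
open scoped BigOperators
open Literature.Algebra.Polynomial (signVar signVarAux)
open Summit.ValiantsHypothesis.ValiantsHypothesis.Theorems.KPlusLogSqLaw.ExactPatchwork
  (mul_eval_pos_of_dominant sum_mul_pow_lt_of_le_of_forall_le sum_mul_pow_lt_of_ge_of_forall_ge
    card_alternating_le_card_posRoots)

/-! ## Dominance bookkeeping -/

/-- the dominant coefficient is non-zero. [folklore] -/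
theorem coeff_ne_zero_of_dominant (f : ℝ[X]) {a : ℝ} (ha : 0 < a) {u : ℕ}
    (hdom : ∑ i ∈ f.support.erase u, |f.coeff i| * a ^ i < |f.coeff u| * a ^ u) : f.coeff u ≠ 0 := by
  intro h
  rw [h, abs_zero, zero_mul] at hdom
  exact absurd hdom (not_lt.mpr (Finset.sum_nonneg fun i _ => mul_nonneg (abs_nonneg _) (pow_nonneg ha.le _)))

/-- a single competitor is beaten by the dominant monomial. [folklore] -/
theorem abs_mul_pow_lt_of_dominant (f : ℝ[X]) {a : ℝ} (ha : 0 < a) {u i : ℕ} (hi : i ≠ u)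
    (hdom : ∑ i ∈ f.support.erase u, |f.coeff i| * a ^ i < |f.coeff u| * a ^ u) :
    |f.coeff i| * a ^ i < |f.coeff u| * a ^ u := by
  classical
  by_cases hs : i ∈ f.support
  · exact lt_of_le_of_lt (Finset.single_le_sum (f := fun j => |f.coeff j| * a ^ j)
      (fun j _ => mul_nonneg (abs_nonneg _) (pow_nonneg ha.le _)) (Finset.mem_erase.mpr ⟨hi, hs⟩)) hdom
  · rw [Polynomial.notMem_support_iff.mp hs, abs_zero, zero_mul]
    have := coeff_ne_zero_of_dominant f ha hdom
    positivity

/-- **Exponents increase along dominance points** (pencil twin of `TropicalCensus.slope_lt_of_dominant`): if `x^u` dominates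
`f` at `a` and `x^w` dominates `f` at `b > a`, then `u ≤ w`. [folklore] -/
theorem le_of_dominant_of_lt (f : ℝ[X]) {a b : ℝ} (ha : 0 < a) (hab : a < b) {u w : ℕ}
    (hdomA : ∑ i ∈ f.support.erase u, |f.coeff i| * a ^ i < |f.coeff u| * a ^ u)
    (hdomB : ∑ i ∈ f.support.erase w, |f.coeff i| * b ^ i < |f.coeff w| * b ^ w) : u ≤ w := by
  by_contra h
  push Not at h
  have hb : 0 < b := ha.trans hab
  have hne : w ≠ u := ne_of_lt h
  have h1 : |f.coeff w| * a ^ w < |f.coeff u| * a ^ u := abs_mul_pow_lt_of_dominant f ha hne hdomA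
  have h2 : |f.coeff u| * b ^ u < |f.coeff w| * b ^ w := abs_mul_pow_lt_of_dominant f hb hne.symm hdomB
  have hcu : 0 < |f.coeff u| := abs_pos.mpr (coeff_ne_zero_of_dominant f ha hdomA)
  obtain ⟨e, rfl⟩ := Nat.exists_eq_add_of_lt h
  -- `|c_w| < |c_u| a^(e+1)` and `|c_u| b^(e+1) < |c_w|`
  have hpa : a ^ (w + e + 1) = a ^ (e + 1) * a ^ w := by rw [← pow_add]; congr 1; omega
  have hpb : b ^ (w + e + 1) = b ^ (e + 1) * b ^ w := by rw [← pow_add]; congr 1; omega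
  rw [hpa, ← mul_assoc] at h1
  rw [hpb, ← mul_assoc] at h2
  have h1' : |f.coeff w| < |f.coeff (w + e + 1)| * a ^ (e + 1) := lt_of_mul_lt_mul_right h1 (pow_nonneg ha.le w)
  have h2' : |f.coeff (w + e + 1)| * b ^ (e + 1) < |f.coeff w| := lt_of_mul_lt_mul_right h2 (pow_nonneg hb.le w)
  have hab' : a ^ (e + 1) < b ^ (e + 1) := pow_lt_pow_left₀ hab ha.le (Nat.succ_ne_zero e)
  have h3 : |f.coeff (w + e + 1)| * a ^ (e + 1) < |f.coeff (w + e + 1)| * b ^ (e + 1) :=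
    mul_lt_mul_of_pos_left hab' hcu
  exact lt_irrefl _ ((h1'.trans h3).trans h2')

/-- **Below the least exponent's dominance point there is no zero**: if every exponent of the support is `≥ u` and `x^u`
dominates `f` at `a`, then `f(x) ≠ 0` for `0 < x ≤ a`. [folklore] -/
theorem eval_ne_zero_of_dominant_of_forall_le (f : ℝ[X]) {a : ℝ} {u : ℕ} (hu : ∀ s ∈ f.support, u ≤ s)
    (hdomA : ∑ i ∈ f.support.erase u, |f.coeff i| * a ^ i < |f.coeff u| * a ^ u)
    {x : ℝ} (hx : 0 < x) (hxa : x ≤ a) : f.eval x ≠ 0 := by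
  have h := sum_mul_pow_lt_of_le_of_forall_le (f.support.erase u) (fun i => |f.coeff i|) (fun _ => abs_nonneg _) u
    (fun s hs => hu s (Finset.mem_of_mem_erase hs)) hx hxa hdomA
  have hpos := mul_eval_pos_of_dominant f hx h
  intro h0
  rw [h0, mul_zero] at hpos
  exact lt_irrefl _ hpos

/-- **Above the largest exponent's dominance point there is no zero**: if every exponent of the support is `≤ u` and `x^u`
dominates `f` at `a > 0`, then `f(x) ≠ 0` for `x ≥ a`. [folklore] -/
theorem eval_ne_zero_of_dominant_of_forall_ge (f : ℝ[X]) {a : ℝ} (ha : 0 < a) {u : ℕ} (hu : ∀ s ∈ f.support, s ≤ u)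
    (hdomA : ∑ i ∈ f.support.erase u, |f.coeff i| * a ^ i < |f.coeff u| * a ^ u)
    {x : ℝ} (hax : a ≤ x) : f.eval x ≠ 0 := by
  have hx : 0 < x := lt_of_lt_of_le ha hax
  have h := sum_mul_pow_lt_of_ge_of_forall_ge (f.support.erase u) (fun i => |f.coeff i|) (fun _ => abs_nonneg _) u
    (fun s hs => hu s (Finset.mem_of_mem_erase hs)) ha hax hdomA
  have hpos := mul_eval_pos_of_dominant f hx h
  intro h0
  rw [h0, mul_zero] at hpos
  exact lt_irrefl _ hpos

/-- **The trailing monomial dominates near `0`** (explicitly): for `f ≠ 0` and every `δ > 0` there is `a ∈ (0, δ)` at which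
`x^{u}`, `u` the trailing degree, dominates `f`. [folklore] -/
theorem exists_dominant_trailing (f : ℝ[X]) (hf : f ≠ 0) {δ : ℝ} (hδ : 0 < δ) :
    ∃ a : ℝ, 0 < a ∧ a < δ ∧
      ∑ i ∈ f.support.erase f.natTrailingDegree, |f.coeff i| * a ^ i
        < |f.coeff f.natTrailingDegree| * a ^ f.natTrailingDegree := by
  classical
  set u := f.natTrailingDegree with hu
  set c : ℝ := |f.coeff u| with hc
  set S : ℝ := ∑ i ∈ f.support.erase u, |f.coeff i| with hS
  have hc0 : 0 < c := by
    rw [hc]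
    exact abs_pos.mpr (Polynomial.mem_support_iff.mp (Polynomial.natTrailingDegree_mem_support_of_nonzero hf))
  have hS0 : 0 ≤ S := Finset.sum_nonneg fun i _ => abs_nonneg _
  set a : ℝ := min (δ / 2) (min (1 / 2) (c / (2 * (S + 1)))) with ha
  have haδ : a ≤ δ / 2 := min_le_left _ _
  have ha1 : a ≤ 1 / 2 := (min_le_right _ _).trans (min_le_left _ _)
  have haS : a ≤ c / (2 * (S + 1)) := (min_le_right _ _).trans (min_le_right _ _)
  have ha0 : 0 < a := by
    rw [ha]
    refine lt_min (by linarith) (lt_min (by norm_num) (div_pos hc0 (by linarith)))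
  refine ⟨a, ha0, by linarith, ?_⟩
  -- every competitor has exponent `≥ u + 1`, so its mass is `≤ |c_i| a^(u+1)` (`a ≤ 1`)
  have hterm : ∀ i ∈ f.support.erase u, |f.coeff i| * a ^ i ≤ |f.coeff i| * a ^ (u + 1) := by
    intro i hi
    obtain ⟨hiu, his⟩ := Finset.mem_erase.mp hi
    have hui : u + 1 ≤ i := by
      have : u ≤ i := Polynomial.natTrailingDegree_le_of_ne_zero (Polynomial.mem_support_iff.mp his)
      omega
    exact mul_le_mul_of_nonneg_left (pow_le_pow_of_le_one ha0.le (by linarith) hui) (abs_nonneg _)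
  have hSa : S * a < c := by
    have h1 : S * a ≤ (S + 1) * a := by nlinarith
    have h2 : (S + 1) * a ≤ (S + 1) * (c / (2 * (S + 1))) := mul_le_mul_of_nonneg_left haS (by linarith)
    have h3 : (S + 1) * (c / (2 * (S + 1))) = c / 2 := by field_simp
    linarith
  calc ∑ i ∈ f.support.erase u, |f.coeff i| * a ^ i
      ≤ ∑ i ∈ f.support.erase u, |f.coeff i| * a ^ (u + 1) := Finset.sum_le_sum hterm
    _ = (S * a) * a ^ u := by rw [← Finset.sum_mul, pow_succ]; ring
    _ < c * a ^ u := mul_lt_mul_of_pos_right hSa (pow_pos ha0 u)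

/-- **The leading monomial dominates near `∞`** (explicitly): for `f ≠ 0` and every `R` there is `b > max(R, 0)` at which
`x^{n}`, `n` the degree, dominates `f`. [folklore] -/
theorem exists_dominant_leading (f : ℝ[X]) (hf : f ≠ 0) (R : ℝ) :
    ∃ b : ℝ, R < b ∧ 0 < b ∧
      ∑ i ∈ f.support.erase f.natDegree, |f.coeff i| * b ^ i < |f.coeff f.natDegree| * b ^ f.natDegree := by
  classical
  set n := f.natDegree with hn
  set c : ℝ := |f.coeff n| with hc
  set S : ℝ := ∑ i ∈ f.support.erase n, |f.coeff i| with hS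
  have hc0 : 0 < c := by
    rw [hc]
    exact abs_pos.mpr (Polynomial.mem_support_iff.mp (Polynomial.natDegree_mem_support_of_nonzero hf))
  have hS0 : 0 ≤ S := Finset.sum_nonneg fun i _ => abs_nonneg _
  set b : ℝ := max (max R 1) ((S + 1) / c) + 1 with hb
  have hbR : R < b := by
    have : R ≤ max (max R 1) ((S + 1) / c) := (le_max_left _ _).trans (le_max_left _ _)
    rw [hb]; linarith
  have hb1 : 1 ≤ b := by
    have : (1 : ℝ) ≤ max (max R 1) ((S + 1) / c) := (le_max_right _ _).trans (le_max_left _ _)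
    rw [hb]; linarith
  have hb0 : 0 < b := lt_of_lt_of_le one_pos hb1
  have hbS : S < c * b := by
    have h1 : (S + 1) / c ≤ max (max R 1) ((S + 1) / c) := le_max_right _ _
    have h2 : (S + 1) / c < b := by rw [hb]; linarith
    have h3 : S + 1 < c * b := by
      have := mul_lt_mul_of_pos_left h2 hc0
      rwa [mul_div_cancel₀ _ hc0.ne'] at this
    linarith
  refine ⟨b, hbR, hb0, ?_⟩
  rcases Nat.eq_zero_or_pos n with hn0 | hn0
  · -- constant polynomial: no competitor at all
    have hempty : f.support.erase n = ∅ := by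
      refine Finset.eq_empty_of_forall_notMem fun i hi => ?_
      obtain ⟨hin, his⟩ := Finset.mem_erase.mp hi
      have : i ≤ n := Polynomial.le_natDegree_of_mem_supp i his
      omega
    rw [hempty, Finset.sum_empty]
    exact mul_pos hc0 (pow_pos hb0 _)
  · -- every competitor has exponent `≤ n − 1`, so its mass is `≤ |c_i| b^(n−1)` (`b ≥ 1`)
    have hterm : ∀ i ∈ f.support.erase n, |f.coeff i| * b ^ i ≤ |f.coeff i| * b ^ (n - 1) := by
      intro i hi
      obtain ⟨hin, his⟩ := Finset.mem_erase.mp hi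
      have hin' : i ≤ n - 1 := by
        have : i ≤ n := Polynomial.le_natDegree_of_mem_supp i his
        omega
      exact mul_le_mul_of_nonneg_left (pow_le_pow_right₀ hb1 hin') (abs_nonneg _)
    have hpow : b ^ n = b * b ^ (n - 1) := by
      rw [← pow_succ']; congr 1; omega
    calc ∑ i ∈ f.support.erase n, |f.coeff i| * b ^ i
        ≤ ∑ i ∈ f.support.erase n, |f.coeff i| * b ^ (n - 1) := Finset.sum_le_sum hterm
      _ = S * b ^ (n - 1) := by rw [← Finset.sum_mul]
      _ < (c * b) * b ^ (n - 1) := mul_lt_mul_of_pos_right hbS (pow_pos hb0 _)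
      _ = c * b ^ n := by rw [hpow]; ring

/-! ## Sign-variation bookkeeping: zero prefixes and windows with zero interior -/

/-- an all-zero prefix is dropped by `Var`. [folklore] -/
theorem signVar_append_of_forall_eq_zero : ∀ (P L : List ℝ), (∀ x ∈ P, x = 0) → signVar (P ++ L) = signVar L
  | [], L, _ => rfl
  | x :: P, L, h => by
    have hx : x = 0 := h x (by simp)
    rw [List.cons_append, hx, signVar_zero_cons]
    exact signVar_append_of_forall_eq_zero P L fun y hy => h y (List.mem_cons_of_mem _ hy)

/-- a window whose interior entries vanish has `Var = [head · last < 0]`. [folklore] -/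
theorem signVar_cons_append_single_of_forall_eq_zero (x y : ℝ) :
    ∀ (L : List ℝ), (∀ z ∈ L, z = 0) → signVar (x :: (L ++ [y])) = if x * y < 0 then 1 else 0
  | [], _ => by
    unfold signVar
    by_cases hx : x = 0
    · subst hx; by_cases hy : y = 0 <;> simp [hy, signVarAux]
    · by_cases hy : y = 0
      · subst hy; simp [hx, signVarAux]
      · simp [hx, hy, signVarAux]
  | z :: L, h => by
    have hz : z = 0 := h z (by simp)
    rw [List.cons_append, hz, signVar_cons_zero_cons]
    exact signVar_cons_append_single_of_forall_eq_zero x y L fun w hw => h w (List.mem_cons_of_mem _ hw)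

/-- the coefficient window `(c_u, …, c_w)` as a list. -/
theorem window_eq_cons_append (f : ℝ[X]) {u w : ℕ} (huw : u < w) :
    (List.range (w + 1 - u)).map (fun k => f.coeff (u + k))
      = f.coeff u :: ((List.range (w - u - 1)).map (fun k => f.coeff (u + 1 + k)) ++ [f.coeff w]) := by
  have h1 : w + 1 - u = 1 + ((w - u - 1) + 1) := by omega
  rw [h1, List.range_add, List.map_append, List.map_map]
  simp only [List.range_one, List.map_cons, List.map_nil, add_zero, List.cons_append, List.nil_append]
  congr 1
  rw [List.range_succ, List.map_append, List.map_singleton]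
  congr 1
  · refine List.map_congr_left fun k _ => ?_
    simp only [Function.comp_apply]
    congr 1; omega
  · simp only [Function.comp_apply]
    congr 2; omega

/-- **`Var` of a window without interior support exponents** is the alternation indicator of its ends. [folklore] -/
theorem signVar_window_of_noInterior (f : ℝ[X]) {u w : ℕ} (huw : u ≤ w)
    (hno : ∀ s ∈ f.support, ¬ (u < s ∧ s < w)) :
    signVar ((List.range (w + 1 - u)).map (fun k => f.coeff (u + k)))
      = if f.coeff u * f.coeff w < 0 then 1 else 0 := by
  rcases Nat.eq_or_lt_of_le huw with rfl | hlt
  · have : u + 1 - u = 1 := by omega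
    rw [this]
    simp only [List.range_one, List.map_cons, List.map_nil, add_zero, signVar_single]
    rw [if_neg (not_lt.mpr (mul_self_nonneg _))]
  · rw [window_eq_cons_append f hlt]
    refine signVar_cons_append_single_of_forall_eq_zero _ _ _ fun z hz => ?_
    rw [List.mem_map] at hz
    obtain ⟨k, hk, rfl⟩ := hz
    rw [List.mem_range] at hk
    by_contra hne
    exact hno (u + 1 + k) (Polynomial.mem_support_iff.mpr hne) ⟨by omega, by omega⟩

/-! ## Laguerre's one-sided rules in dominance form -/

/-- **ONE-SIDED RULE BELOW A DOMINANCE POINT.**  If `x^w` dominates `f` at `a > 0`, the number of distinct zeros of `f` in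
`(0, a)` is at most `Var(c_0, c_1, …, c_w)`. Proof: the trailing monomial `x^u` (`u ≤ w`) dominates at some point `a'` below
every positive zero (`exists_dominant_trailing`), the two-sided local rule counts the zeros in `(a', a)` by `Var(c_u..c_w)`, and
`c_i = 0` for `i < u`. [folklore] (Laguerre) -/
theorem card_roots_lt_le_signVar (f : ℝ[X]) {a : ℝ} (ha : 0 < a) {w : ℕ}
    (hdomA : ∑ i ∈ f.support.erase w, |f.coeff i| * a ^ i < |f.coeff w| * a ^ w) :
    (f.roots.toFinset.filter (fun x => 0 < x ∧ x < a)).card ≤ signVar ((List.range (w + 1)).map f.coeff) := by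
  classical
  have hcw : f.coeff w ≠ 0 := coeff_ne_zero_of_dominant f ha hdomA
  have hf : f ≠ 0 := fun h => hcw (by rw [h, Polynomial.coeff_zero])
  set u := f.natTrailingDegree with hu
  have huw : u ≤ w := Polynomial.natTrailingDegree_le_of_ne_zero hcw
  set R := f.roots.toFinset.filter (fun x => 0 < x ∧ x < a) with hR
  -- the window `(c_u, …, c_w)` has the same `Var` as `(c_0, …, c_w)`
  have hwin : signVar ((List.range (w + 1)).map f.coeff)
      = signVar ((List.range (w + 1 - u)).map (fun k => f.coeff (u + k))) := by
    have : w + 1 = u + (w + 1 - u) := by omega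
    rw [this, List.range_add, List.map_append, List.map_map]
    have h2 : w + 1 - u = u + (w + 1 - u) - u := by omega
    rw [← h2]
    refine signVar_append_of_forall_eq_zero _ _ fun x hx => ?_
    rw [List.mem_map] at hx
    obtain ⟨k, hk, rfl⟩ := hx
    exact Polynomial.coeff_eq_zero_of_lt_natTrailingDegree (List.mem_range.mp hk)
  rw [hwin]
  rcases Finset.eq_empty_or_nonempty R with hRe | hRne
  · rw [hRe, Finset.card_empty]; exact Nat.zero_le _
  -- an auxiliary dominance point of the trailing monomial below every zero of `R`
  set t₀ := R.min' hRne with ht₀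
  have ht₀R : t₀ ∈ R := Finset.min'_mem R hRne
  have ht₀pos : 0 < t₀ := (Finset.mem_filter.mp ht₀R).2.1
  have ht₀a : t₀ < a := (Finset.mem_filter.mp ht₀R).2.2
  obtain ⟨a', ha'0, ha'δ, hdom'⟩ := exists_dominant_trailing f hf (lt_min ha ht₀pos)
  have ha'a : a' < a := lt_of_lt_of_le ha'δ (min_le_left _ _)
  have ha't : a' < t₀ := lt_of_lt_of_le ha'δ (min_le_right _ _)
  have hsub : R ⊆ f.roots.toFinset.filter (fun x => a' < x ∧ x < a) := by
    intro t ht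
    have htmin : t₀ ≤ t := Finset.min'_le R t ht
    rw [Finset.mem_filter] at ht ⊢
    exact ⟨ht.1, lt_of_lt_of_le ha't htmin, ht.2.2⟩
  exact (Finset.card_le_card hsub).trans (card_roots_Ioo_le_signVar_coeffs f ha'0 ha'a huw hdom' hdomA)

/-- **ONE-SIDED RULE ABOVE A DOMINANCE POINT.**  If `x^u` dominates `f` at `a > 0`, the number of distinct zeros of `f` in
`(a, ∞)` is at most `Var(c_u, c_{u+1}, …, c_n)`, `n` the degree. Proof: the leading monomial dominates at some point beyond
every zero (`exists_dominant_leading`); apply the two-sided local rule on `(a, b')`. [folklore] (Laguerre) -/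
theorem card_roots_gt_le_signVar (f : ℝ[X]) {a : ℝ} (ha : 0 < a) {u : ℕ}
    (hdomA : ∑ i ∈ f.support.erase u, |f.coeff i| * a ^ i < |f.coeff u| * a ^ u) :
    (f.roots.toFinset.filter (fun x => a < x)).card
      ≤ signVar ((List.range (f.natDegree + 1 - u)).map (fun k => f.coeff (u + k))) := by
  classical
  have hcu : f.coeff u ≠ 0 := coeff_ne_zero_of_dominant f ha hdomA
  have hf : f ≠ 0 := fun h => hcu (by rw [h, Polynomial.coeff_zero])
  have hun : u ≤ f.natDegree := Polynomial.le_natDegree_of_ne_zero hcu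
  set R := f.roots.toFinset.filter (fun x => a < x) with hR
  rcases Finset.eq_empty_or_nonempty R with hRe | hRne
  · rw [hRe, Finset.card_empty]; exact Nat.zero_le _
  set t₁ := R.max' hRne with ht₁
  obtain ⟨b', hb'R, hb'0, hdom'⟩ := exists_dominant_leading f hf (max a t₁)
  have hab' : a < b' := lt_of_le_of_lt (le_max_left _ _) hb'R
  have htb' : t₁ < b' := lt_of_le_of_lt (le_max_right _ _) hb'R
  have hsub : R ⊆ f.roots.toFinset.filter (fun x => a < x ∧ x < b') := by
    intro t ht
    have htmax : t ≤ t₁ := Finset.le_max' R t ht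
    rw [Finset.mem_filter] at ht ⊢
    exact ⟨ht.1, ht.2, lt_of_le_of_lt htmax htb'⟩
  exact (Finset.card_le_card hsub).trans (card_roots_Ioo_le_signVar_coeffs f ha hab' hun hdomA hdom')

end Summit.ValiantsHypothesis.ValiantsHypothesis.Theorems.KPlusLogSqLaw.LocalDescartes
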